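import Literature.AlgebraicGeometry.FormalGeometry.TowerModuleCokernel
import Mathlib.CategoryTheory.Preadditive.Biproducts
import Mathlib.CategoryTheory.Limits.Preserves.Shapes.Zero
import HarnessLib

/-!
# Modules over a tower of schemes form an additive category: zero object and direct sums

Görtz–Wedhorn, *Algebraic Geometry II* (2023), §(24.18): the category `((X_n)_n-Mod)` of modules
over a tower (Def. 24.85; `Literature.AlgebraicGeometry.FormalGeometry.TowerModule`) is additive
and the formal completion functor `ℱ ↦ ℱ_{/Z}` (24.18.1) is an additive functor; direct sums such as
`𝒪^n_{X_{/Z}}` and `𝒪_{X_{/Z}}(-m)^r` are the sources of the presentations used in the proofs of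
Prop. 24.88 (p. 564) and Lemma 24.103 (p. 570). On top of the preadditive structure
(`TowerModuleCokernel`) this file constructs, level by level,

* the **zero module over the tower** `TowerModule.zeroObj = (0)_n` (structure isomorphisms
  `(t n)^* 0 ≅ 0`, Mathlib `Functor.mapZeroObject`) and `HasZeroObject (TowerModule Y t)`;
* the **direct sum** `TowerModule.biprodObj ℰ ℱ = (ℰ_n ⊕ ℱ_n)_n` (structure isomorphisms
  `(t n)^*(ℰ_{n+1} ⊕ ℱ_{n+1}) ≅ (t n)^*ℰ_{n+1} ⊕ (t n)^*ℱ_{n+1} ≅ ℰ_n ⊕ ℱ_n`: the inverse images are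
  additive functors, Mathlib `Functor.mapBiprod`, then `biprod.mapIso`), its binary bicone
  `binaryBicone ℰ ℱ` with `binaryBiconeIsBilimit` (`isBinaryBilimitOfTotal`), hence
  `HasBinaryBiproducts (TowerModule Y t)` and `HasFiniteBiproducts (TowerModule Y t)`: **`((X_n)_n-Mod)`
  is an additive category**; `biprodObjIso : ℰ ⊞ ℱ ≅ biprodObj ℰ ℱ` identifies the chosen direct sum
  with the level-wise one;
* `biprodObj_isVectorBundle`: a direct sum of locally free modules of finite type over the tower is
  locally free of finite type.

The level functors, the completion functor and base change are additive
(`TowerModuleCokernel`, `TowerModuleBaseChange`), hence preserve these direct sums (Mathlib).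

## References

* U. Görtz, T. Wedhorn, *Algebraic Geometry II: Cohomology of Schemes*, Springer Spektrum 2023,
  Def. 24.85 and (24.18.1) (pp. 561–562), Prop. 24.88 (p. 564), Lemma 24.103 (p. 570).
  [GortzWedhorn2023]
-/

noncomputable section

open CategoryTheory CategoryTheory.Limits ZeroObject

namespace Literature.AlgebraicGeometry.FormalGeometry

open _root_.AlgebraicGeometry

universe u

/-- Inverse images of modules preserve binary direct sums (they are additive functors; Mathlib
`preservesBinaryBiproducts_of_preservesBiproducts`). Local instance. [folklore] -/
theorem preservesBinaryBiproducts_pullback {X X' : Scheme.{u}} (f : X ⟶ X') :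
    PreservesBinaryBiproducts (Scheme.Modules.pullback f) :=
  preservesBinaryBiproducts_of_preservesBiproducts _

attribute [local instance] preservesBinaryBiproducts_pullback

namespace TowerModule

variable {Y : ℕ → Scheme.{u}} {t : ∀ n, Y n ⟶ Y (n + 1)}

/-! ### The zero module over the tower -/

/-- **The zero module `(0)_n` over a tower**, with structure isomorphisms `(t n)^* 0 ≅ 0`
(`Functor.mapZeroObject`). [folklore] -/
abbrev zeroObj : TowerModule Y t :=
  { obj := fun _ => 0
    iso := fun n => (Scheme.Modules.pullback (t n)).mapZeroObject }

/-- The zero module over the tower is a zero object of `((X_n)_n-Mod)`. [folklore] -/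
theorem isZero_zeroObj : IsZero (zeroObj : TowerModule Y t) := by
  rw [IsZero.iff_id_eq_zero]
  exact hom_ext fun _ => id_zero

/-- `((X_n)_n-Mod)` has a zero object. [folklore] -/
instance hasZeroObject : HasZeroObject (TowerModule Y t) :=
  ⟨⟨zeroObj, isZero_zeroObj⟩⟩

/-- The zero module over the tower is locally free (of rank `0`). [folklore] -/
theorem zeroObj_isVectorBundle : (zeroObj : TowerModule Y t).IsVectorBundle :=
  fun _ => (Motives.hasRankLE_zero_of_isZero (isZero_zero _)).isFiniteLocallyFree.isVectorBundle

/-! ### Direct sums, level by level -/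

section Biprod

variable (E F : TowerModule Y t)

/-- **The direct sum `(ℰ_n ⊕ ℱ_n)_n` of two modules over a tower**, with structure isomorphisms
`(t n)^*(ℰ_{n+1} ⊕ ℱ_{n+1}) ≅ (t n)^*ℰ_{n+1} ⊕ (t n)^*ℱ_{n+1} ≅ ℰ_n ⊕ ℱ_n` (`Functor.mapBiprod` for the
additive functor `(t n)^*`, then `biprod.mapIso` of the structure isomorphisms). Declared `abbrev`
so that its levels are reducibly `ℰ_n ⊞ ℱ_n`. [cite: GortzWedhorn2023, Def. 24.85 and (24.18.1) (pp. 561–562)] -/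
abbrev biprodObj : TowerModule Y t :=
  { obj := fun n => E.obj n ⊞ F.obj n
    iso := fun n => (Scheme.Modules.pullback (t n)).mapBiprod (E.obj (n + 1)) (F.obj (n + 1)) ≪≫
      biprod.mapIso (E.iso n) (F.iso n) }

/-- First projection `(ℰ_n ⊕ ℱ_n)_n → ℰ` (level-wise `biprod.fst`). [folklore] -/
abbrev biprodFst : biprodObj E F ⟶ E :=
  { app := fun n => biprod.fst
    comm := fun n => by
      simp only [Iso.trans_hom, Functor.mapBiprod_hom, biprod.mapIso_hom, Category.assoc,
        biprod.map_fst, biprod.lift_fst_assoc] }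

/-- Second projection `(ℰ_n ⊕ ℱ_n)_n → ℱ` (level-wise `biprod.snd`). [folklore] -/
abbrev biprodSnd : biprodObj E F ⟶ F :=
  { app := fun n => biprod.snd
    comm := fun n => by
      simp only [Iso.trans_hom, Functor.mapBiprod_hom, biprod.mapIso_hom, Category.assoc,
        biprod.map_snd, biprod.lift_snd_assoc] }

/-- First inclusion `ℰ → (ℰ_n ⊕ ℱ_n)_n` (level-wise `biprod.inl`). [folklore] -/
abbrev biprodInl : E ⟶ biprodObj E F :=
  { app := fun n => biprod.inl
    comm := fun n => by
      refine biprod.hom_ext _ _ ?_ ?_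
      · simp only [Iso.trans_hom, Functor.mapBiprod_hom, biprod.mapIso_hom, Category.assoc,
          biprod.map_fst, biprod.lift_fst_assoc, ← CategoryTheory.Functor.map_comp_assoc,
          biprod.inl_fst, CategoryTheory.Functor.map_id, Category.id_comp, Category.comp_id]
      · simp only [Iso.trans_hom, Functor.mapBiprod_hom, biprod.mapIso_hom, Category.assoc,
          biprod.map_snd, biprod.lift_snd_assoc, ← CategoryTheory.Functor.map_comp_assoc,
          biprod.inl_snd, CategoryTheory.Functor.map_zero, zero_comp, comp_zero] }

/-- Second inclusion `ℱ → (ℰ_n ⊕ ℱ_n)_n` (level-wise `biprod.inr`). [folklore] -/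
abbrev biprodInr : F ⟶ biprodObj E F :=
  { app := fun n => biprod.inr
    comm := fun n => by
      refine biprod.hom_ext _ _ ?_ ?_
      · simp only [Iso.trans_hom, Functor.mapBiprod_hom, biprod.mapIso_hom, Category.assoc,
          biprod.map_fst, biprod.lift_fst_assoc, ← CategoryTheory.Functor.map_comp_assoc,
          biprod.inr_fst, CategoryTheory.Functor.map_zero, zero_comp, comp_zero]
      · simp only [Iso.trans_hom, Functor.mapBiprod_hom, biprod.mapIso_hom, Category.assoc,
          biprod.map_snd, biprod.lift_snd_assoc, ← CategoryTheory.Functor.map_comp_assoc,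
          biprod.inr_snd, CategoryTheory.Functor.map_id, Category.id_comp, Category.comp_id] }

/-- **The level-wise binary bicone of two modules over a tower.**
[cite: GortzWedhorn2023, Def. 24.85 and (24.18.1) (pp. 561–562)] -/
def binaryBicone : BinaryBicone E F where
  pt := biprodObj E F
  fst := biprodFst E F
  snd := biprodSnd E F
  inl := biprodInl E F
  inr := biprodInr E F
  inl_fst := hom_ext fun _ => biprod.inl_fst
  inl_snd := hom_ext fun _ => biprod.inl_snd
  inr_fst := hom_ext fun _ => biprod.inr_fst
  inr_snd := hom_ext fun _ => biprod.inr_snd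

/-- **The level-wise direct sum is a biproduct in `((X_n)_n-Mod)`** (`isBinaryBilimitOfTotal`:
`fst ≫ inl + snd ≫ inr = 𝟙` holds level-wise, `biprod.total`).
[cite: GortzWedhorn2023, Def. 24.85 and (24.18.1) (pp. 561–562)] -/
def binaryBiconeIsBilimit : (binaryBicone E F).IsBilimit :=
  isBinaryBilimitOfTotal _ (hom_ext fun _ => biprod.total)

/-- `((X_n)_n-Mod)` has binary direct sums (level-wise). [folklore] -/
instance hasBinaryBiproducts : HasBinaryBiproducts (TowerModule Y t) :=
  ⟨fun E F => HasBinaryBiproduct.mk ⟨_, binaryBiconeIsBilimit E F⟩⟩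

/-- **`((X_n)_n-Mod)` is an additive category**: it has all finite direct sums (from the zero object
and binary direct sums, Mathlib `HasFiniteBiproducts.of_hasFiniteProducts` via finite products).
[cite: GortzWedhorn2023, (24.18.1) (p. 562)] -/
instance hasFiniteBiproducts : HasFiniteBiproducts (TowerModule Y t) := by
  haveI : HasBinaryProducts (TowerModule Y t) := hasBinaryProducts_of_hasBinaryBiproducts
  haveI : HasTerminal (TowerModule Y t) := HasZeroObject.hasTerminal
  haveI : HasFiniteProducts (TowerModule Y t) := hasFiniteProducts_of_has_binary_and_terminal
  exact HasFiniteBiproducts.of_hasFiniteProducts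

/-- The chosen direct sum `ℰ ⊞ ℱ` is (canonically isomorphic to) the level-wise one. [folklore] -/
def biprodObjIso : E ⊞ F ≅ biprodObj E F :=
  (biprod.uniqueUpToIso E F (binaryBiconeIsBilimit E F)).symm

/-- **Level `n` of a direct sum: `(ℰ ⊞ ℱ)_n ≅ ℰ_n ⊞ ℱ_n`.** [folklore] -/
def biprodObjIsoApp (n : ℕ) : (E ⊞ F).obj n ≅ E.obj n ⊞ F.obj n :=
  evalMapIso (biprodObjIso E F) n

variable {E F} in
/-- **A direct sum of locally free modules of finite type over a tower is locally free of finite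
type** (level-wise: an extension of finite locally free modules is finite locally free, tree
`isFiniteLocallyFree_of_shortExact` for the split sequence `0 → ℰ_n → ℰ_n ⊕ ℱ_n → ℱ_n → 0`).
[folklore] -/
theorem biprodObj_isVectorBundle (hE : E.IsVectorBundle) (hF : F.IsVectorBundle) :
    (biprodObj E F).IsVectorBundle :=
  fun n => (Motives.isFiniteLocallyFree_of_shortExact
    (ShortComplex.Splitting.ofHasBinaryBiproduct (E.obj n) (F.obj n)).shortExact
    (hE n).isFiniteLocallyFree (hF n).isFiniteLocallyFree).isVectorBundle

variable {E F} in
/-- The chosen direct sum of locally free modules of finite type over a tower is locally free of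
finite type. [folklore] -/
theorem biprod_isVectorBundle (hE : E.IsVectorBundle) (hF : F.IsVectorBundle) :
    (E ⊞ F).IsVectorBundle :=
  (biprodObj_isVectorBundle hE hF).of_iso (biprodObjIso E F).symm

end Biprod

end TowerModule

end Literature.AlgebraicGeometry.FormalGeometry

end
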